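import Summits.KontsevichZagierPeriods.KontsevichZagierPeriods.Theorems.TerasomaMultiplicationCompleteModGammaSectorStubCertificateTransport
import Summits.KontsevichZagierPeriods.KontsevichZagierPeriods.Theorems.TerasomaMultiplicationCompleteModGammaSectorLegendreCertificate
import Summits.KontsevichZagierPeriods.KontsevichZagierPeriods.Theorems.TerasomaMultiplicationCompleteModGammaSectorLegendrePotentials
import Summits.KontsevichZagierPeriods.KontsevichZagierPeriods.Theorems.TerasomaMultiplicationCompleteModGammaSectorLegendreSemialgebraic
import Summits.KontsevichZagierPeriods.KontsevichZagierPeriods.Theorems.TerasomaMultiplicationCompleteModGammaSectorLegendreIntegrable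
import Literature.NumberTheory.Transcendental.KZLogCalculusProofs

/-!
# `CompleteModGammaSector` (stmt-KontsevichZagierPeriods-14233) — engine client I: Legendre's modulus propagation
(`= GaussManinCertificates.LegendreModulusPropagation`, stmt-KontsevichZagierPeriods-3014, VERBATIM)

For real algebraic `m₀, m₁ ∈ (0,1)` the Legendre representations `[(0,1)², F_{m₀}]`, `[(0,1)², F_{m₁}]`
(`F_m(x,y) = κₘ(x)e_{1−m}(y) + eₘ(x)κ_{1−m}(y) − κₘ(x)κ_{1−m}(y)`, value `EK′ + E′K − KK′ = π/2`) are
equivalent in the Kontsevich–Zagier calculus: flat transport in the modulus by the engine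
`stub_certificateTransport` (one Newton–Leibniz move in `m` over `(0,1)²`, two box-Stokes moves), fed with
the divergence certificate `∂ₘF = ∂ₓG₁ + ∂_yG₂` (`stub_legendreCertificate`; `G₁ = ½x(1−x²)y²κκ`,
`G₂ = −½x²y(1−y²)κκ`), the potentials (`stub_legendrePotentialX/Y`), semialgebraicity
(`stub_legendreSemialgebraic`) and integrability (`stub_legendreIntegrable`). No CM fibre, no limit.

References: Kontsevich–Zagier 2001 §1.2; McKean–Moll 1999 §2.4 (Legendre's relation).
-/

noncomputable section
set_option linter.dupNamespace false

namespace Summit.KontsevichZagierPeriods.KontsevichZagierPeriods.CompleteModGammaSectorEngine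

open MeasureTheory Set
open Literature.NumberTheory.Transcendental
open Literature.NumberTheory.Transcendental.KZ

/-! ## Fin 3 bookkeeping -/

/-- Components of `Fin.snoc x s : Fin 3 → ℝ`. [folklore] -/
private theorem snoc_two_apply_zero (x : Fin 2 → ℝ) (s : ℝ) : (Fin.snoc x s : Fin 3 → ℝ) 0 = x 0 := by
  show Fin.snoc (α := fun _ : Fin 3 => ℝ) x s (Fin.castSucc (0 : Fin 2)) = x 0
  rw [Fin.snoc_castSucc]

/-- Components of `Fin.snoc x s : Fin 3 → ℝ`. [folklore] -/
private theorem snoc_two_apply_one (x : Fin 2 → ℝ) (s : ℝ) : (Fin.snoc x s : Fin 3 → ℝ) 1 = x 1 := by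
  show Fin.snoc (α := fun _ : Fin 3 => ℝ) x s (Fin.castSucc (1 : Fin 2)) = x 1
  rw [Fin.snoc_castSucc]

/-- Components of `Fin.snoc x s : Fin 3 → ℝ`. [folklore] -/
private theorem snoc_two_apply_two (x : Fin 2 → ℝ) (s : ℝ) : (Fin.snoc x s : Fin 3 → ℝ) 2 = s := by
  show Fin.snoc (α := fun _ : Fin 3 => ℝ) x s (Fin.last 2) = s
  rw [Fin.snoc_last]

/-! ## The assembly -/

/-- **Registered stub `stub_legendreModulusPropagation`** = `GaussManinCertificates.LegendreModulusPropagation`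
(stmt-KontsevichZagierPeriods-3014) VERBATIM: for real algebraic `m₀, m₁ ∈ (0,1)` the Legendre
representations `F_{m₀}`, `F_{m₁}` on `(0,1)²` are KZ-equivalent — flat transport in the modulus by
the engine `stub_certificateTransport` (one Newton–Leibniz move in `m`, two box-Stokes moves) fed
with the certificate `∂ₘF = ∂ₓG₁ + ∂_yG₂` (`stub_legendreCertificate`), the potentials
(`stub_legendrePotentialX/Y`), semialgebraicity (`stub_legendreSemialgebraic`) and integrability
(`stub_legendreIntegrable`); the orientation `m₁ < m₀` by symmetry, `m₀ = m₁` by congruence of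
pinned representations. [cite: KontsevichZagier2001, §1.2] -/
theorem stub_legendreModulusPropagation :
    ∀ (F : ℝ → (Fin 2 → ℝ) → ℝ), (∀ (m : ℝ) (x : Fin 2 → ℝ), F m x = 1 / Real.sqrt ((1 - x 0 ^ 2) * (1 - m * x 0 ^ 2)) * (Real.sqrt (1 - (1 - m) * x 1 ^ 2) / Real.sqrt (1 - x 1 ^ 2)) + Real.sqrt (1 - m * x 0 ^ 2) / Real.sqrt (1 - x 0 ^ 2) * (1 / Real.sqrt ((1 - x 1 ^ 2) * (1 - (1 - m) * x 1 ^ 2))) - 1 / Real.sqrt ((1 - x 0 ^ 2) * (1 - m * x 0 ^ 2)) * (1 / Real.sqrt ((1 - x 1 ^ 2) * (1 - (1 - m) * x 1 ^ 2)))) → ∀ (m₀ m₁ : ℝ), IsAlgebraic ℚ m₀ → IsAlgebraic ℚ m₁ → m₀ ∈ Set.Ioo (0 : ℝ) 1 → m₁ ∈ Set.Ioo (0 : ℝ) 1 → ∀ (r₀ r₁ : IntegralRep 2), r₀.domain = {x | ∀ i, x i ∈ Set.Ioo (0 : ℝ) 1} → r₁.domain = {x | ∀ i, x i ∈ Set.Ioo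 (0 : ℝ) 1} → Set.EqOn r₀.integrand (F m₀) r₀.domain → Set.EqOn r₁.integrand (F m₁) r₁.domain → Equivalent r₀ r₁ := by
  intro F hF
  -- the transport for ORDERED moduli
  have key : ∀ (m₀ m₁ : ℝ), IsAlgebraic ℚ m₀ → IsAlgebraic ℚ m₁ → m₀ ∈ Set.Ioo (0:ℝ) 1 →
      m₁ ∈ Set.Ioo (0:ℝ) 1 → m₀ < m₁ → ∀ (r₀ r₁ : IntegralRep 2),
      r₀.domain = {x | ∀ i, x i ∈ Set.Ioo (0:ℝ) 1} → r₁.domain = {x | ∀ i, x i ∈ Set.Ioo (0:ℝ) 1} →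
      Set.EqOn r₀.integrand (F m₀) r₀.domain → Set.EqOn r₁.integrand (F m₁) r₁.domain →
      Equivalent r₀ r₁ := by
    intro m₀ m₁ h₀ h₁ hm₀ hm₁ hlt r₀ r₁ hr₀d hr₁d hr₀i hr₁i
    obtain ⟨hSF, hSG₁, hSG₂, hSg₁, hSg₂⟩ := stub_legendreSemialgebraic m₀ m₁ h₀ h₁ hm₀.1 hlt hm₁.2
    obtain ⟨hIg₁, hIg₂⟩ := stub_legendreIntegrable m₀ m₁ hm₀.1 hlt hm₁.2
    -- the data fed to the engine (n = 2, parameter last): F, g = (∂ₓG₁, ∂_yG₂), G = (G₁, G₂)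
    refine stub_certificateTransport 2 m₀ m₁
      (fun z : Fin 3 → ℝ => (1 / Real.sqrt ((1 - z 0 ^ 2) * (1 - z 2 * z 0 ^ 2)) * (Real.sqrt (1 - (1 - z 2) * z 1 ^ 2) / Real.sqrt (1 - z 1 ^ 2)) + Real.sqrt (1 - z 2 * z 0 ^ 2) / Real.sqrt (1 - z 0 ^ 2) * (1 / Real.sqrt ((1 - z 1 ^ 2) * (1 - (1 - z 2) * z 1 ^ 2))) - 1 / Real.sqrt ((1 - z 0 ^ 2) * (1 - z 2 * z 0 ^ 2)) * (1 / Real.sqrt ((1 - z 1 ^ 2) * (1 - (1 - z 2) * z 1 ^ 2)))))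
      ![(fun z : Fin 3 → ℝ => (1 / 2 * z 1 ^ 2 * (1 / (Real.sqrt (1 - z 0 ^ 2) * Real.sqrt (1 - z 2 * z 0 ^ 2))) * (1 / (Real.sqrt (1 - z 1 ^ 2) * Real.sqrt (1 - (1 - z 2) * z 1 ^ 2))) * ((1 - 2 * z 0 ^ 2) + z 2 * z 0 ^ 2 * (1 - z 0 ^ 2) / (1 - z 2 * z 0 ^ 2)))),
        (fun z : Fin 3 → ℝ => (-(1 / 2 * z 0 ^ 2 * (1 / (Real.sqrt (1 - z 0 ^ 2) * Real.sqrt (1 - z 2 * z 0 ^ 2))) * (1 / (Real.sqrt (1 - z 1 ^ 2) * Real.sqrt (1 - (1 - z 2) * z 1 ^ 2))) * ((1 - 2 * z 1 ^ 2) + (1 - z 2) * z 1 ^ 2 * (1 - z 1 ^ 2) / (1 - (1 - z 2) * z 1 ^ 2)))))]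
      ![(fun z : Fin 3 → ℝ => (1 / 2 * z 0 * Real.sqrt (1 - z 0 ^ 2) * z 1 ^ 2 / (Real.sqrt (1 - z 2 * z 0 ^ 2) * Real.sqrt (1 - z 1 ^ 2) * Real.sqrt (1 - (1 - z 2) * z 1 ^ 2)))),
        (fun z : Fin 3 → ℝ => (-(1 / 2 * z 0 ^ 2 * z 1 * Real.sqrt (1 - z 1 ^ 2) / (Real.sqrt (1 - z 0 ^ 2) * Real.sqrt (1 - z 2 * z 0 ^ 2) * Real.sqrt (1 - (1 - z 2) * z 1 ^ 2)))))]
      r₀ r₁ hlt h₀ h₁ hSF ?_ ?_ ?_ ?_ ?_ hr₀d ?_ hr₁d ?_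
    · -- semialgebraicity of the potentials on their bands
      intro i
      fin_cases i
      · simpa using hSG₁
      · simpa using hSG₂
    · -- semialgebraicity of the divergence pieces on the open band
      intro i
      fin_cases i
      · simpa using hSg₁
      · simpa using hSg₂
    · -- integrability of the divergence pieces
      intro i
      fin_cases i
      · simpa using hIg₁
      · simpa using hIg₂
    · -- the family in the modulus: continuity on [m₀, m₁] and the CERTIFICATE inside
      intro x hx
      have e : (fun s : ℝ => (fun z : Fin 3 → ℝ => (1 / Real.sqrt ((1 - z 0 ^ 2) * (1 - z 2 * z 0 ^ 2)) * (Real.sqrt (1 - (1 - z 2) * z 1 ^ 2) / Real.sqrt (1 - z 1 ^ 2)) + Real.sqrt (1 - z 2 * z 0 ^ 2) / Real.sqrt (1 - z 0 ^ 2) * (1 / Real.sqrt ((1 - z 1 ^ 2) * (1 - (1 - z 2) * z 1 ^ 2))) - 1 / Real.sqrt ((1 - z 0 ^ 2) * (1 - z 2 * z 0 ^ 2)) * (1 / Real.sqrt ((1 - z 1 ^ 2) * (1 - (1 - z 2) * z 1 ^ 2))))) (Fin.snoc x s)) = fun s => F s x := by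
        funext s
        rw [hF]
        simp only [snoc_two_apply_zero, snoc_two_apply_one, snoc_two_apply_two]
      refine ⟨?_, fun s hs => ?_⟩
      · rw [e]
        exact stub_legendreContinuousModulus F hF x m₀ m₁ (hx 0) (hx 1) hm₀.1 hm₁.2
      · rw [e]
        have hs01 : s ∈ Set.Ioo (0:ℝ) 1 := ⟨hm₀.1.trans hs.1, hs.2.trans hm₁.2⟩
        have hd := stub_legendreCertificate F hF x s (hx 0) (hx 1) hs01
        simpa only [Fin.sum_univ_two, Matrix.cons_val_zero, Matrix.cons_val_one, Matrix.head_cons,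
          snoc_two_apply_zero, snoc_two_apply_one, snoc_two_apply_two] using hd
    · -- the potentials along their coordinate: continuity on [0,1], vanishing on the faces, derivative
      refine Fin.forall_fin_two.mpr ⟨fun z hz => ?_, fun z hz => ?_⟩
      · have hy : z 1 ∈ Set.Ioo (0:ℝ) 1 := hz.1 1
        have hm : z 2 ∈ Set.Ioo (0:ℝ) 1 := ⟨hm₀.1.trans hz.2.1, hz.2.2.trans hm₁.2⟩
        have hP := stub_legendrePotentialX (z 1) (z 2) hy hm
        simp only [Matrix.cons_val_zero]
        exact hP
      · have hx' : z 0 ∈ Set.Ioo (0:ℝ) 1 := hz.1 0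
        have hm : z 2 ∈ Set.Ioo (0:ℝ) 1 := ⟨hm₀.1.trans hz.2.1, hz.2.2.trans hm₁.2⟩
        have hP := stub_legendrePotentialY (z 0) (z 2) hx' hm
        simp only [Matrix.cons_val_one]
        exact hP
    · -- pinning of the end fibres
      intro x hx
      rw [hr₀i hx, hF]
      simp only [snoc_two_apply_zero, snoc_two_apply_one, snoc_two_apply_two]
    · intro x hx
      rw [hr₁i hx, hF]
      simp only [snoc_two_apply_zero, snoc_two_apply_one, snoc_two_apply_two]
  intro m₀ m₁ h₀ h₁ hm₀ hm₁ r₀ r₁ hr₀d hr₁d hr₀i hr₁i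
  rcases lt_trichotomy m₀ m₁ with hlt | heq | hgt
  · exact key m₀ m₁ h₀ h₁ hm₀ hm₁ hlt r₀ r₁ hr₀d hr₁d hr₀i hr₁i
  · subst heq
    exact of_sub_of_mem_relations_of_eqOn (hr₁d.trans hr₀d.symm) fun x hx =>
      (hr₀i hx).trans (hr₁i (by rw [hr₁d]; rw [hr₀d] at hx; exact hx)).symm
  · exact (key m₁ m₀ h₁ h₀ hm₁ hm₀ hgt r₁ r₀ hr₁d hr₀d hr₁i hr₀i).symm

end Summit.KontsevichZagierPeriods.KontsevichZagierPeriods.CompleteModGammaSectorEngine
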